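/-
Copyright: literature formalisation for the harness. Statements follow the cited text.
-/
import Literature.AlgebraicGeometry.CossartPiltant200819.NormalModelAbove2008
import Literature.AlgebraicGeometry.CossartPiltant200819.TameSegment2008
import Mathlib.FieldTheory.Galois.Basic
import Mathlib.Algebra.Ring.GeomSum
import Mathlib.Data.Nat.Prime.Infinite
import HarnessLib

/-!
# Cossart–Piltant I (2008), Prop 6.2 (1) — Galois approximation, PROVED

Topic: `Literature/AlgebraicGeometry/CossartPiltant200819`.  This module DISCHARGES the named
fact `CP2008.GaloisApproximation` of `Ramification2008.lean` — the tree's rendering of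

  V. Cossart, O. Piltant, *Resolution of singularities of threefolds in positive
  characteristic. I*, J. Algebra 320 (2008) 1051–1082, **Proposition 6.2 (1)** (HAL
  hal-00139124, p. 17), PRINTED TEXT: "(Galois approximation) Let `L/K` be a Galois extension
  of function fields over `k` and let `W/k` be a `k`-valuation ring such that `QF(W) = L`. Let
  `V := W ∩ K`. For any given normal local model `R` of `V/k`, let `R̃` be the unique normal
  local model of `W/k` which lies above `R`, and let `Rˢ` (resp. `Rⁱ`) be the splitting ring
  (resp. inertia ring) of `R̃` over `R`. There exists a normal local model `R₀` of `V/k` such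
  that for any normal local model `R` of `V/k` dominating `R₀`, the following holds. (1) We have
  `G_s(W/V) = G_s(R̃/R)` and `G_i(W/V) = G_i(R̃/R)`, (26) i.e. `Rˢ = R̃^{G_s(W/V)}` and
  `Rⁱ = R̃^{G_i(W/V)}`."

(with `G_s(R̃/R) = {g | g.R̃ = R̃}`, `G_i(R̃/R) = {g ∈ G_s(R̃/R) | ∀ x ∈ R̃, g.x ≡ x mod m_R̃}`,
HAL p. 5 (2)–(3), exactly as typed in `CP2008.GaloisApproximation`) — as the theorem
`galoisApproximation_holds : GaloisApproximation`.  No new definition, no named fact.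

PRINTED PROOF of (1) (HAL p. 18 l. 1–13): "Since `V` is the direct union of all its normal
local models `R`, its integral closure `V̄` in `L` is the direct union of all corresponding
integral closures `R̄` in `L`. Since the extensions of `V` to `L` are the localizations of `V̄`
at its maximal ideals `m₁, …, m_s`, any `R₀` such that for `1 ≤ i ≤ s`, the `m(W_i) ∩ R̄₀`'s
are pairwise distinct satisfies the statement about splitting groups in (1) of the
proposition. Let now `R` be any normal local model of `V/k` such that `R₀ < R`. By definition
of the inertia group, there is an inclusion `G_i(W/V) ⊆ G_i(R̃/R)`. Let `t₁, …, t_f` be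
elements of `W` whose residues `t̄₁, …, t̄_f` generate the `κ(V)`-vector space `κ(W)`. After
possibly changing `R₀`, it can be assumed that `κ(V)/κ(R₀)` is algebraic and that
`t₁, …, t_f ∈ R̃₀`. Then any `g ∈ G_i(R̃/R) ⊆ G_s(W/V)` maps to `ḡ ∈ Gal(κ(W)/κ(V))` such that
`ḡ.t̄_i = t̄_i`, `1 ≤ i ≤ f`. Therefore `g ∈ G_i(W/V)` and this concludes the proof of (1)."

PROOF RENDERED.  The structure is the printed one — `R₀` is a normal local model of `V` whose
normal model above, `R̃₀ ⊆ R̃`, contains (a) for every conjugate `W_j = τW ≠ W` an element of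
`m(W_j)` which is a unit of `W` (so that the centres `m(W_j) ∩ R̄` are pairwise distinct) and
(b) enough elements of `W` to detect the action of `G_s(W/V)` on `κ(W)` — with two
Mathlib-level substitutions for facts the library lacks.  (i) "The extensions of `V` to `L`
are the localizations of `V̄` at its maximal ideals" (Zariski–Samuel II, Ch. VI §7, Thm. 12 and
Cor. 3) is replaced by an elementary device in the spirit of Zariski–Samuel's independence
lemma for pairwise incomparable places (Ch. VI §7, Lemma 1, where `1/x`, `1/(x+1)`, `x/(x±1)`,
`(x³+x²+x)/(x³+x+1)` serve): for `x ∈ L` and ONE prime `ν` exceeding the residue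
characteristic of `W` and the multiplicative orders of the residues of the conjugates `ρx ∈ W`,
the sum `s = 1 + x + ⋯ + x^{ν-1}` has `ρ(1/s), ρ(x/s) ∈ W` for EVERY `ρ ∈ G`
(`exists_prime_geom_sum`; the conjugates `τW` are pairwise incomparable, `smul_eq_of_le`).
Hence the ring `B = ⋂_ρ ρW` — whose elements are roots of the monic polynomials `∏_ρ (X − ρy)`
with coefficients in `V` by Galois descent (`exists_monic_of_forall_map_mem`), so lie in `R̃`
as soon as `R` contains these coefficients — contains, for every `τ` with `τW ≠ W`, a unit `b`
of `W` with `τb ∈ m_W` (`exists_separating`), and, for every `σ ∈ G_s(W/V) ∖ G_i(W/V)`, an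
element `y` with `σy ≢ y mod m_W` (`exists_inertia_witness`: if `σ` moves the residue of
`x ∈ W` it moves that of `1/s` or of `x/s`).  (ii) Instead of residue generators `t₁, …, t_f`
(finiteness of `[κ(W) : κ(V)]` is not available in Mathlib in this generality) the witnesses
`y` of (b), one for each of the finitely many `σ ∈ G_s ∖ G_i`, are put into `R̃₀`.
`R₀` itself is produced by `exists_isNormalLocalModelOf_forall_mem`: enlarge an affine model of
`V` (`Resolution.exists_affineModel`) by the finitely many coefficients, take the integral
closure in `K` — an affine `k`-algebra by E. Noether (`integralClosureSub_fg`,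
`NormalModelAbove2008.lean`) — and localise at the centre of `V` (`coe_ofField_centre`).
For `R ⊇ R₀` normal: `g.W = W ⇒ g.R̃ = R̃` since `R̃ = {b/t : b, t integral over R, W(t) = 0}`
is built from `R ⊆ K` and `W` (`image_normalModelAbove_eq`); `g.R̃ = R̃ ⇒ g.W = W` since
otherwise the unit `b ∈ R̃` of (a) for `τ = g` has `1/b ∈ R̃` and `g(1/b) = 1/g(b) ∉ W ⊇ R̃`;
`G_i(W/V) ⊆ G_i(R̃/R)` as printed (`R̃ ⊆ W`, `normalModelAbove_subset`), and conversely an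
element of `G_i(R̃/R)` lies in `G_s(W/V)` by the above and fixes the residues of the witnesses
`y ∈ R̃`, hence lies in `G_i(W/V)` (`mem_inertiaGroup_iff'`, `TameSegment2008.lean`).

What is NOT here: "`R̃` is the unique normal local model of `W/k` above `R`" (the tree's
`normalModelAbove W R` is a set; that it is a local model of `W` is
`CP2008.normalModelAboveLe_holds`, `NormalModelAbove2008.lean`), and Prop. 6.2 (2)
(`κ(Rʳ) = κ(Rⁱ)`, completions), which the tree does not state.
-/

namespace Literature.AlgebraicGeometry.CossartPiltant200819.CP2008

open Literature.AlgebraicGeometry.Resolution IsLocalRing Polynomial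
open scoped Pointwise

universe u

/-! ### Geometric sums against a valuation ring -/

section GeomSum

variable {F : Type u} [Field F]

/-- In a field, `1 + x + ⋯ + x^{n-1} ≠ 0` as soon as `n` is a prime exceeding both the
characteristic and the multiplicative order of `x`. [folklore] -/
theorem geom_sum_ne_zero_of_prime {x : F} {n : ℕ} (hn : n.Prime) (hchar : ringChar F < n)
    (hord : orderOf x < n) : ∑ i ∈ Finset.range n, x ^ i ≠ 0 := by
  intro h
  by_cases hx : x = 1
  · subst hx
    rw [one_geom_sum] at h
    rcases (Nat.dvd_prime hn).mp (ringChar.dvd h) with h1 | h2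
    · exact CharP.ringChar_ne_one h1
    · exact absurd h2 (ne_of_lt hchar)
  · have h2 : x ^ n = 1 := by
      have h3 := geom_sum_mul x n
      rw [h, zero_mul] at h3
      exact (sub_eq_zero.mp h3.symm)
    rcases (Nat.dvd_prime hn).mp (orderOf_dvd_of_pow_eq_one h2) with h1 | h3
    · exact hx (orderOf_eq_one_iff.mp h1)
    · exact absurd h3 (ne_of_lt hord)

/-- For `x ∈ W` whose residue `x̄` has `1 + x̄ + ⋯ + x̄^{n-1} ≠ 0` in `κ(W)`, the sum
`1 + x + ⋯ + x^{n-1}` is a unit of `W`. [folklore] -/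
theorem valuation_geom_sum_eq_one (W : ValuationSubring F) {x : F} (hx : x ∈ W) {n : ℕ}
    (hres : ∑ i ∈ Finset.range n, (residue W ⟨x, hx⟩) ^ i ≠ 0) :
    W.valuation (∑ i ∈ Finset.range n, x ^ i) = 1 := by
  have hmem : ∑ i ∈ Finset.range n, x ^ i ∈ W := sum_mem fun i _ => pow_mem hx i
  have heq : (⟨∑ i ∈ Finset.range n, x ^ i, hmem⟩ : W) = ∑ i ∈ Finset.range n, (⟨x, hx⟩ : W) ^ i :=
    Subtype.ext (by simp)
  have hres' : residue W ⟨∑ i ∈ Finset.range n, x ^ i, hmem⟩ ≠ 0 := by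
    rw [heq, map_sum]
    simp_rw [map_pow]
    exact hres
  have hunit : IsUnit (⟨∑ i ∈ Finset.range n, x ^ i, hmem⟩ : W) :=
    (residue_ne_zero_iff_isUnit _).mp hres'
  exact (W.valuation_eq_one_iff _).mp hunit

/-- For `x ∉ W` (i.e. `W(x) < 0` additively) and `n ≥ 2`, the top term dominates:
`W(1 + x + ⋯ + x^{n-1}) = (n-1)·W(x)`. [folklore] -/
theorem valuation_geom_sum_of_not_mem (W : ValuationSubring F) {x : F} (hx : x ∉ W) {n : ℕ}
    (hn : 2 ≤ n) :
    W.valuation (∑ i ∈ Finset.range n, x ^ i) = W.valuation x ^ (n - 1) := by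
  classical
  have h1 : 1 < W.valuation x := not_le.mp (mt (W.valuation_le_one_iff x).mp hx)
  have hmem : n - 1 ∈ Finset.range n := Finset.mem_range.mpr (by omega)
  rw [W.valuation.map_sum_eq_of_lt hmem]
  · exact map_pow _ _ _
  · intro i hi
    rw [Finset.mem_sdiff, Finset.mem_range, Finset.mem_singleton] at hi
    rw [map_pow, map_pow]
    exact pow_lt_pow_right₀ h1 (by omega)

/-- For `x ∉ W` and `n ≥ 2`, with `s = 1 + x + ⋯ + x^{n-1}`: `s ≠ 0`, `1/s ∈ m_W` and
`x/s ∈ W`. [folklore] -/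
theorem geom_sum_inv_of_not_mem (W : ValuationSubring F) {x : F} (hx : x ∉ W) {n : ℕ}
    (hn : 2 ≤ n) :
    W.valuation (∑ i ∈ Finset.range n, x ^ i) ≠ 0 ∧
      W.valuation (∑ i ∈ Finset.range n, x ^ i)⁻¹ < 1 ∧
      x * (∑ i ∈ Finset.range n, x ^ i)⁻¹ ∈ W := by
  have h1 : 1 < W.valuation x := not_le.mp (mt (W.valuation_le_one_iff x).mp hx)
  have h0 : 0 < W.valuation x := lt_trans zero_lt_one h1
  have hs := valuation_geom_sum_of_not_mem W hx hn
  have hspos : 1 < W.valuation (∑ i ∈ Finset.range n, x ^ i) := by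
    rw [hs]
    exact one_lt_pow₀ h1 (by omega)
  have hs0 : 0 < W.valuation (∑ i ∈ Finset.range n, x ^ i) := lt_trans zero_lt_one hspos
  refine ⟨ne_of_gt hs0, ?_, ?_⟩
  · rw [map_inv₀]
    exact (inv_lt_one₀ hs0).mpr hspos
  · rw [← W.valuation_le_one_iff, map_mul, map_inv₀, hs]
    obtain ⟨m, hm⟩ : ∃ m, n - 1 = m + 1 := ⟨n - 2, by omega⟩
    rw [hm, pow_succ', mul_inv, mul_inv_cancel_left₀ h0.ne']
    exact (inv_le_one₀ (pow_pos h0 m)).mpr (one_le_pow₀ h1.le)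

/-- **Geometric-sum normalisation of a finite family against one valuation ring** (a uniform
variant of the device of Zariski–Samuel II, Ch. VI §7, Lemma 1): for finitely many `x_i ∈ F`
there is one prime `n ≥ 2` such that, with `s_i = 1 + x_i + ⋯ + x_i^{n-1}`: `W(s_i) ≠ 0` in the
value group (so `s_i ≠ 0`), `1/s_i ∈ W`, `x_i/s_i ∈ W`; moreover `s_i` is a unit of `W` when
`x_i ∈ W`, and `1/s_i ∈ m_W` when `x_i ∉ W`. (Take `n` larger than the residue characteristic
and than the multiplicative orders of the residues `x̄_i`.) [folklore] -/
theorem exists_prime_geom_sum (W : ValuationSubring F) {ι : Type*} [Finite ι] (x : ι → F) :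
    ∃ n : ℕ, 2 ≤ n ∧ ∀ i,
      W.valuation (∑ j ∈ Finset.range n, x i ^ j) ≠ 0 ∧
      (∑ j ∈ Finset.range n, x i ^ j)⁻¹ ∈ W ∧
      x i * (∑ j ∈ Finset.range n, x i ^ j)⁻¹ ∈ W ∧
      (x i ∈ W → W.valuation (∑ j ∈ Finset.range n, x i ^ j) = 1) ∧
      (x i ∉ W → W.valuation (∑ j ∈ Finset.range n, x i ^ j)⁻¹ < 1) := by
  classical
  haveI := Fintype.ofFinite ι
  let N : ι → ℕ := fun i => if h : x i ∈ W then orderOf (residue W ⟨x i, h⟩) else 0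
  obtain ⟨n, hn, hprime⟩ :=
    Nat.exists_infinite_primes (ringChar (ResidueField W) + Finset.univ.sup N + 2)
  refine ⟨n, by omega, fun i => ?_⟩
  have hchar : ringChar (ResidueField W) < n := by omega
  have hN : N i < n := lt_of_le_of_lt (Finset.le_sup (Finset.mem_univ i)) (by omega)
  by_cases hxi : x i ∈ W
  · have hord : orderOf (residue W ⟨x i, hxi⟩) < n := by
      have h := hN
      simp only [N, dif_pos hxi] at h
      exact h
    have hv : W.valuation (∑ j ∈ Finset.range n, x i ^ j) = 1 :=
      valuation_geom_sum_eq_one W hxi (geom_sum_ne_zero_of_prime hprime hchar hord)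
    have hsinv : (∑ j ∈ Finset.range n, x i ^ j)⁻¹ ∈ W := by
      rw [← W.valuation_le_one_iff, map_inv₀, hv, inv_one]
    exact ⟨by rw [hv]; exact one_ne_zero, hsinv, mul_mem hxi hsinv, fun _ => hv,
      fun h => absurd hxi h⟩
  · obtain ⟨hs0, hlt, hxs⟩ := geom_sum_inv_of_not_mem W hxi (by omega : 2 ≤ n)
    exact ⟨hs0, (W.valuation_le_one_iff _).mp hlt.le, hxs, fun h => absurd h hxi, fun _ => hlt⟩

end GeomSum

/-! ### Conjugates of `W` under the Galois group: separating and inertia witnesses -/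

section Galois

variable {K L : Type u} [Field K] [Field L] [Algebra K L] [FiniteDimensional K L]

/-- **Conjugate valuation rings are incomparable**: `W ⊆ τW` forces `τW = W` (iterate `τ`,
which has finite order). [folklore] -/
theorem smul_eq_of_le (W : ValuationSubring L) (τ : L ≃ₐ[K] L) (h : W ≤ τ • W) :
    τ • W = W := by
  have step : ∀ m : ℕ, τ ^ m • W ≤ τ ^ (m + 1) • W := fun m => by
    rw [pow_succ, mul_smul]
    exact ValuationSubring.pointwise_smul_le_pointwise_smul_iff.mpr h
  have hchain : ∀ m : ℕ, τ • W ≤ τ ^ (m + 1) • W := by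
    intro m
    induction m with
    | zero => rw [zero_add, pow_one]
    | succ m ih => exact ih.trans (step (m + 1))
  obtain ⟨m, hm⟩ : ∃ m, orderOf τ = m + 1 := ⟨orderOf τ - 1, by have := orderOf_pos τ; omega⟩
  have h2 : τ • W ≤ W := by
    have h3 := hchain m
    rwa [← hm, pow_orderOf_eq_one, one_smul] at h3
  exact le_antisymm h2 h

/-- `τW ⊆ W` forces `τW = W`. [folklore] -/
theorem smul_eq_of_ge (W : ValuationSubring L) (τ : L ≃ₐ[K] L) (h : τ • W ≤ W) :
    τ • W = W := by
  have h1 : W ≤ τ⁻¹ • W := by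
    have h2 := (ValuationSubring.pointwise_smul_le_pointwise_smul_iff (g := τ⁻¹)).mpr h
    rwa [inv_smul_smul] at h2
  have h2 := smul_eq_of_le W τ⁻¹ h1
  calc τ • W = τ • (τ⁻¹ • W) := by rw [h2]
    _ = W := smul_inv_smul τ W

/-- If `τW ≠ W` there is a unit `x` of `W` with `τ x ∉ W`. [folklore] -/
theorem exists_unit_map_not_mem (W : ValuationSubring L) {τ : L ≃ₐ[K] L} (hτ : τ • W ≠ W) :
    ∃ x ∈ W, W.valuation x = 1 ∧ τ x ∉ W := by
  have hne : τ⁻¹ • W ≠ W := fun h => hτ (by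
    calc τ • W = τ • (τ⁻¹ • W) := by rw [h]
      _ = W := smul_inv_smul τ W)
  have hnle : ¬ W ≤ τ⁻¹ • W := fun h => hne (smul_eq_of_le W τ⁻¹ h)
  obtain ⟨x₀, hx₀W, hx₀⟩ := SetLike.not_le_iff_exists.mp hnle
  rw [ValuationSubring.mem_inv_pointwise_smul_iff, AlgEquiv.smul_def] at hx₀
  rcases W.valuation_lt_one_or_eq_one ⟨x₀, hx₀W⟩ with hlt | heq
  · refine ⟨1 + x₀, add_mem (one_mem W) hx₀W, W.valuation.map_one_add_of_lt hlt, fun h => hx₀ ?_⟩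
    have h1 : τ x₀ = τ (1 + x₀) - 1 := by rw [map_add, map_one, add_sub_cancel_left]
    rw [h1]
    exact sub_mem h (one_mem W)
  · exact ⟨x₀, hx₀W, heq, hx₀⟩

/-- **Separating witness.** If `τW ≠ W` there is `b ∈ L` ALL of whose `K`-conjugates lie in `W`,
which is a unit of `W` and satisfies `τ b ∈ m_W` (`b = 1/(1 + x + ⋯ + x^{ν-1})` for a unit `x`
of `W` with `τ x ∉ W` and the prime `ν` of `exists_prime_geom_sum`). [folklore] -/
theorem exists_separating (W : ValuationSubring L) {τ : L ≃ₐ[K] L} (hτ : τ • W ≠ W) :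
    ∃ b : L, (∀ ρ : L ≃ₐ[K] L, ρ b ∈ W) ∧ W.valuation b = 1 ∧ W.valuation (τ b) < 1 := by
  obtain ⟨x, hxW, -, hτx⟩ := exists_unit_map_not_mem W hτ
  obtain ⟨n, -, hgood⟩ := exists_prime_geom_sum W (fun ρ : L ≃ₐ[K] L => ρ x)
  have hρs : ∀ ρ : L ≃ₐ[K] L,
      ρ (∑ j ∈ Finset.range n, x ^ j) = ∑ j ∈ Finset.range n, (ρ x) ^ j := fun ρ => by
    rw [map_sum]
    simp_rw [map_pow]
  refine ⟨(∑ j ∈ Finset.range n, x ^ j)⁻¹, fun ρ => ?_, ?_, ?_⟩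
  · rw [map_inv₀, hρs]
    exact (hgood ρ).2.1
  · have h1 : W.valuation (∑ j ∈ Finset.range n, x ^ j) = 1 := by
      have h2 := (hgood 1).2.2.2.1 (by simpa using hxW)
      simpa using h2
    rw [map_inv₀, h1, inv_one]
  · rw [map_inv₀, hρs]
    exact (hgood τ).2.2.2.2 (by simpa using hτx)

/-- **Inertia witness.** If `σW = W` but `σ` does not act trivially on `κ(W)` (witnessed by
`x ∈ W`), there is `y ∈ L` all of whose `K`-conjugates lie in `W` with `σ y ≢ y mod m_W`
(one of `1/s`, `x/s` for `s = 1 + x + ⋯ + x^{ν-1}`, since `x = (x/s)·s`). [folklore] -/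
theorem exists_inertia_witness (W : ValuationSubring L) {σ : L ≃ₐ[K] L} (hσ : σ • W = W)
    {x : L} (hxW : x ∈ W) (hx : ¬ W.valuation (σ x - x) < 1) :
    ∃ y : L, (∀ ρ : L ≃ₐ[K] L, ρ y ∈ W) ∧ ¬ W.valuation (σ y - y) < 1 := by
  obtain ⟨n, -, hgood⟩ := exists_prime_geom_sum W (fun ρ : L ≃ₐ[K] L => ρ x)
  have hρs : ∀ ρ : L ≃ₐ[K] L,
      ρ (∑ j ∈ Finset.range n, x ^ j) = ∑ j ∈ Finset.range n, (ρ x) ^ j := fun ρ => by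
    rw [map_sum]
    simp_rw [map_pow]
  have hu : ∀ ρ : L ≃ₐ[K] L, ρ (∑ j ∈ Finset.range n, x ^ j)⁻¹ ∈ W := fun ρ => by
    rw [map_inv₀, hρs]
    exact (hgood ρ).2.1
  have hxu : ∀ ρ : L ≃ₐ[K] L, ρ (x * (∑ j ∈ Finset.range n, x ^ j)⁻¹) ∈ W := fun ρ => by
    rw [map_mul, map_inv₀, hρs]
    exact (hgood ρ).2.2.1
  have hvs : W.valuation (∑ j ∈ Finset.range n, x ^ j) = 1 := by
    have h2 := (hgood 1).2.2.2.1 (by simpa using hxW)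
    simpa using h2
  by_contra hcon
  push Not at hcon
  have h1 := hcon _ hu
  have h2 := hcon _ hxu
  set s := ∑ j ∈ Finset.range n, x ^ j with hs_def
  have hs0 : s ≠ 0 := ne_zero_of_valuation_eq_one W hvs
  have hsW : s ∈ W := sum_mem fun j _ => pow_mem hxW j
  have hσs : σ s ∈ W := map_mem_of_smul_eq W σ hσ hsW
  have hσs0 : σ s ≠ 0 := (_root_.map_ne_zero σ).mpr hs0
  have hxsW : x * s⁻¹ ∈ W := by simpa using hxu 1
  have key : σ x - x =
      (σ (x * s⁻¹) - x * s⁻¹) * σ s + ((s⁻¹ - σ s⁻¹) * (σ s * s)) * (x * s⁻¹) := by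
    rw [map_mul, map_inv₀]
    field_simp
    ring
  have h1' : W.valuation (s⁻¹ - σ s⁻¹) < 1 := by
    rw [Valuation.map_sub_swap]
    exact h1
  apply hx
  rw [key]
  apply Valuation.map_add_lt
  · exact valuation_mul_lt_one h2 hσs
  · exact valuation_mul_lt_one (valuation_mul_lt_one h1' (mul_mem hσs hsW)) hxsW

/-- **Galois descent of the integral equation.** If all `K`-conjugates of `y ∈ L` lie in `W`
(`L/K` Galois), then `y` is a root of a monic polynomial over `K` whose coefficients lie in
`V = W ∩ K` — namely `∏_{ρ ∈ G} (X − ρ y)`, whose coefficients are `G`-invariant. [folklore] -/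
theorem exists_monic_of_forall_map_mem [IsGalois K L] (W : ValuationSubring L) {y : L}
    (hy : ∀ ρ : L ≃ₐ[K] L, ρ y ∈ W) :
    ∃ q : K[X], q.Monic ∧ (∀ i, algebraMap K L (q.coeff i) ∈ W) ∧ aeval y q = 0 := by
  classical
  let P : L[X] := ∏ ρ : L ≃ₐ[K] L, (X - C (ρ y))
  have hPmonic : P.Monic := monic_prod_of_monic _ _ fun ρ _ => monic_X_sub_C (ρ y)
  have hPfix : ∀ σ : L ≃ₐ[K] L, P.map (σ : L →+* L) = P := by
    intro σ
    simp only [P, Polynomial.map_prod, Polynomial.map_sub, map_X, map_C, RingHom.coe_coe]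
    exact Fintype.prod_equiv (Equiv.mulLeft σ) _ _ fun ρ => rfl
  have hcoef : ∀ i, ∃ c : K, algebraMap K L c = P.coeff i := by
    intro i
    have hfix : ∀ σ : L ≃ₐ[K] L, σ (P.coeff i) = P.coeff i := fun σ => by
      conv_rhs => rw [← hPfix σ]
      rw [Polynomial.coeff_map]
      rfl
    exact (IsGalois.mem_range_algebraMap_iff_fixed (P.coeff i)).mpr hfix
  choose c hc using hcoef
  have hlifts : P ∈ Polynomial.lifts (algebraMap K L) :=
    (Polynomial.lifts_iff_coeff_lifts P).mpr fun i => ⟨c i, hc i⟩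
  obtain ⟨q, hqP, -, hqm⟩ := Polynomial.lifts_and_degree_eq_and_monic hlifts hPmonic
  -- the coefficients of `P` lie in `W`
  let Pw : W[X] := ∏ ρ : L ≃ₐ[K] L, (X - C (⟨ρ y, hy ρ⟩ : W))
  have hPw : P = Pw.map W.subtype := by
    simp only [P, Pw, Polynomial.map_prod, Polynomial.map_sub, map_X, map_C]
    rfl
  refine ⟨q, hqm, fun i => ?_, ?_⟩
  · have h1 : algebraMap K L (q.coeff i) = P.coeff i := by rw [← hqP, Polynomial.coeff_map]
    rw [h1, hPw, Polynomial.coeff_map]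
    exact SetLike.coe_mem _
  · have h0 : aeval y P = 0 := by
      rw [map_prod]
      exact Finset.prod_eq_zero (Finset.mem_univ (1 : L ≃ₐ[K] L)) (by simp)
    rwa [← hqP, Polynomial.aeval_map_algebraMap] at h0

end Galois

/-! ### Integrality over a subring of `K` and the set `R̃` -/

section OverSub

variable {k K L : Type u} [Field k] [Field K] [Algebra k K] [Field L] [Algebra K L]

/-- `1` is integral over any `R`. [folklore] -/
theorem isIntegralOverSub_one (R : Subalgebra k K) : IsIntegralOverSub (L := L) R 1 := by
  refine ⟨X - C 1, monic_X_sub_C 1, fun i => ?_, by simp⟩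
  rw [coeff_sub, coeff_X, coeff_C]
  split_ifs <;> simp

/-- Integrality over `R` is monotone in `R`. [folklore] -/
theorem IsIntegralOverSub.mono {R R' : Subalgebra k K} (h : R ≤ R') {b : L}
    (hb : IsIntegralOverSub R b) : IsIntegralOverSub R' b := by
  obtain ⟨q, hqm, hqc, hqb⟩ := hb
  exact ⟨q, hqm, fun i => h (hqc i), hqb⟩

/-- Integrality over `R ⊆ K` is preserved by `K`-automorphisms. [folklore] -/
theorem IsIntegralOverSub.map_algEquiv {R : Subalgebra k K} {b : L} (hb : IsIntegralOverSub R b)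
    (σ : L ≃ₐ[K] L) : IsIntegralOverSub R (σ b) := by
  obtain ⟨q, hqm, hqc, hqb⟩ := hb
  refine ⟨q, hqm, hqc, ?_⟩
  rw [aeval_algHom_apply, hqb, map_zero]

/-- An element integral over a subring `R` of `V = W ∩ K` lies in `W` (valuation rings are
integrally closed). [folklore] -/
theorem IsIntegralOverSub.mem_of_forall_mem {R : Subalgebra k K} (W : ValuationSubring L)
    (hRW : ∀ a ∈ R, algebraMap K L a ∈ W) {b : L} (hb : IsIntegralOverSub R b) : b ∈ W := by
  obtain ⟨q, hqm, hqc, hqb⟩ := hb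
  have hlifts : q ∈ Polynomial.lifts (algebraMap R K) :=
    (Polynomial.lifts_iff_coeff_lifts q).mpr fun i => ⟨⟨q.coeff i, hqc i⟩, rfl⟩
  obtain ⟨p, hpq, -, hpm⟩ := Polynomial.lifts_and_degree_eq_and_monic hlifts hqm
  refine mem_of_isIntegral_of_forall_mem W R hRW ⟨p, hpm, ?_⟩
  have h0 : aeval b q = 0 := hqb
  rw [← hpq, Polynomial.aeval_map_algebraMap, Polynomial.aeval_def] at h0
  exact h0

/-- `b ∈ R̃` for `b` integral over `R` (`b = b/1`). [folklore] -/
theorem mem_normalModelAbove_of_isIntegralOverSub {R : Subalgebra k K} (W : ValuationSubring L)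
    {b : L} (hb : IsIntegralOverSub R b) : b ∈ normalModelAbove W R :=
  ⟨b, 1, hb, isIntegralOverSub_one R, by simp, by simp⟩

/-- `1/b ∈ R̃` for `b` integral over `R` with `W(b) = 0` (`= 1/b`). [folklore] -/
theorem inv_mem_normalModelAbove {R : Subalgebra k K} (W : ValuationSubring L) {b : L}
    (hb : IsIntegralOverSub R b) (hvb : W.valuation b = 1) : b⁻¹ ∈ normalModelAbove W R :=
  ⟨1, b, isIntegralOverSub_one R, hb, hvb, by simp⟩

/-- `R̃ ⊆ W` when `R ⊆ V = W ∩ K`. [folklore] -/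
theorem normalModelAbove_subset {R : Subalgebra k K} (W : ValuationSubring L)
    (hRW : ∀ a ∈ R, algebraMap K L a ∈ W) : normalModelAbove W R ⊆ (W : Set L) := by
  rintro x ⟨b, t, hb, ht, hvt, rfl⟩
  have hbW : b ∈ W := hb.mem_of_forall_mem W hRW
  have htinv : t⁻¹ ∈ W := by
    rw [← W.valuation_le_one_iff, map_inv₀, hvt, inv_one]
  exact mul_mem hbW htinv

/-- `g.W = W ⇒ g.R̃ ⊆ R̃`. [folklore] -/
theorem image_normalModelAbove_subset {R : Subalgebra k K} (W : ValuationSubring L)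
    {σ : L ≃ₐ[K] L} (hσ : σ • W = W) :
    σ '' normalModelAbove W R ⊆ normalModelAbove W R := by
  rintro x ⟨z, ⟨b, t, hb, ht, hvt, rfl⟩, rfl⟩
  have ht0 : t ≠ 0 := ne_zero_of_valuation_eq_one W hvt
  have htW : t ∈ W := (W.valuation_le_one_iff t).mp hvt.le
  have htinv : t⁻¹ ∈ W := by
    rw [← W.valuation_le_one_iff, map_inv₀, hvt, inv_one]
  have hvσt : W.valuation (σ t) = 1 := by
    rw [valuation_eq_one_iff_ne_zero_mem_inv_mem]
    refine ⟨(_root_.map_ne_zero σ).mpr ht0, map_mem_of_smul_eq W σ hσ htW, ?_⟩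
    rw [← map_inv₀]
    exact map_mem_of_smul_eq W σ hσ htinv
  refine ⟨σ b, σ t, hb.map_algEquiv σ, ht.map_algEquiv σ, hvσt, ?_⟩
  rw [map_mul, map_inv₀]

/-- **`g.W = W ⇒ g.R̃ = R̃`** (`R̃` is defined from `R ⊆ K` and `W` alone). [folklore] -/
theorem image_normalModelAbove_eq {R : Subalgebra k K} (W : ValuationSubring L)
    {σ : L ≃ₐ[K] L} (hσ : σ • W = W) :
    σ '' normalModelAbove W R = normalModelAbove W R := by
  refine Set.Subset.antisymm (image_normalModelAbove_subset W hσ) fun x hx => ?_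
  have hσ' : σ⁻¹ • W = W := by
    rw [inv_smul_eq_iff, hσ]
  have h1 : σ⁻¹ x ∈ normalModelAbove W R :=
    image_normalModelAbove_subset W hσ' (Set.mem_image_of_mem _ hx)
  refine ⟨σ⁻¹ x, h1, ?_⟩
  change σ (σ.symm x) = x
  exact σ.apply_symm_apply x

end OverSub

/-! ### A normal local model of `V` containing finitely many prescribed elements -/

section NormalModel

variable {k K : Type u} [Field k] [Field K] [Algebra k K]

/-- A local model is dominated by `O`: `R ⊆ O`. [folklore] -/
theorem IsLocalModelOf.mem_of_mem {O : ValuationSubring K} {R : Subalgebra k K}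
    (hR : IsLocalModelOf k K O R) {x : K} (hx : x ∈ R) : x ∈ O := by
  obtain ⟨A, -, -, hAO, hReq⟩ := hR
  have hx' : x ∈ (R : Set K) := hx
  rw [hReq] at hx'
  obtain ⟨a, ha, s, -, hvs, rfl⟩ := hx'
  have haO : a ∈ O := (O.mem_toSubring a).mp (hAO (show a ∈ A.toSubring from ha))
  have hsO : s⁻¹ ∈ O := by
    rw [← O.valuation_le_one_iff, map_inv₀, hvs, inv_one]
  exact mul_mem haO hsO

/-- **A normal local model of `V/k` containing prescribed elements** (the step "After
possibly changing `R₀`, it can be assumed that … `t₁, …, t_f ∈ R̃₀`" of the proof of Prop. 6.2,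
HAL p. 18 l. 9–10, made explicit): for `K/k` finitely generated, `O ⊇ k` a valuation ring of `K`
and a finite `F ⊆ O`, enlarge an affine model of `O` by `F`, take its integral closure `B` in `K`
(an affine `k`-algebra, E. Noether) and localise at the centre of `O`; the result `B_𝔭 ⊆ K` is a
normal local model of `O` containing `F`. [cite: CossartPiltant2008, Prop 6.2 (1) (HAL p. 17)] -/
theorem exists_isNormalLocalModelOf_forall_mem (hKfg : (⊤ : IntermediateField k K).FG)
    (O : ValuationSubring K) (hk : ∀ c : k, algebraMap k K c ∈ O) (F : Finset K)
    (hF : ∀ x ∈ F, x ∈ O) :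
    ∃ R₀ : Subalgebra k K, IsNormalLocalModelOf k K O R₀ ∧ ∀ x ∈ F, x ∈ R₀ := by
  classical
  obtain ⟨A, hAO, hAfg, hAfrac⟩ := Resolution.exists_affineModel k K hKfg O hk
  haveI : IsFractionRing A K := hAfrac
  obtain ⟨t, ht⟩ := hAfg
  -- the enlarged affine model
  let A₁ : Subalgebra k K := Algebra.adjoin k ((t ∪ F : Finset K) : Set K)
  have hA₁fg : A₁.FG := Subalgebra.fg_adjoin_finset _
  have hAA₁ : A ≤ A₁ := by
    rw [← ht]
    exact Algebra.adjoin_mono (by simp [Finset.coe_union])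
  have hFA₁ : ∀ x ∈ F, x ∈ A₁ := fun x hx =>
    Algebra.subset_adjoin (by simp [hx])
  let Oalg : Subalgebra k K := { O.toSubring with algebraMap_mem' := hk }
  have htO : ∀ x ∈ t, x ∈ O := fun x hx =>
    (O.mem_toSubring x).mp (hAO (show x ∈ A.toSubring from by
      rw [← ht]; exact Algebra.subset_adjoin (Finset.mem_coe.mpr hx)))
  have hA₁O : A₁ ≤ Oalg := Algebra.adjoin_le fun x hx => by
    rcases Finset.mem_union.mp (Finset.mem_coe.mp hx) with h | h
    · exact htO x h
    · exact hF x h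
  have hA₁O' : ∀ a ∈ A₁, algebraMap K K a ∈ O := fun a ha => hA₁O ha
  haveI hA₁frac : IsFractionRing A₁ K := by
    refine IsFractionRing.of_field A₁ K fun z => ?_
    obtain ⟨a, b, -, hab⟩ := IsFractionRing.div_surjective (A := A) z
    exact ⟨⟨a, hAA₁ a.2⟩, ⟨b, hAA₁ b.2⟩, hab.symm⟩
  -- its integral closure in `K`
  let B : Subalgebra k K := integralClosureSub k (L := K) A₁
  have hmemB : ∀ x, x ∈ B ↔ IsIntegral A₁ x := mem_integralClosureSub_iff A₁
  have hBfg : B.FG := integralClosureSub_fg A₁ hA₁fg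
  haveI hBfrac : IsFractionRing B K := isFractionRing_integralClosureSub A₁
  have hBO : B.toSubring ≤ O.toSubring := fun x hx =>
    (O.mem_toSubring x).mpr (mem_of_isIntegral_of_forall_mem O A₁ hA₁O' ((hmemB x).mp hx))
  have hA₁B : A₁ ≤ B := fun x hx => (hmemB x).mpr (by
    have : x = algebraMap A₁ K ⟨x, hx⟩ := rfl
    rw [this]
    exact isIntegral_algebraMap)
  haveI : IsFractionRing B.toSubring K := isFractionRing_toSubring B
  -- `R₀ := B` localised at the centre of `O`, realised inside `K`
  set P := Ideal.comap (Subring.inclusion hBO) (IsLocalRing.maximalIdeal O) with hP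
  let T₁ : Subalgebra B.toSubring K :=
    Localization.subalgebra.ofField K P.primeCompl (Ideal.primeCompl_le_nonZeroDivisors _)
  have hT₁ : (T₁ : Set K) = {x | ∃ a ∈ B, ∃ s ∈ B, O.valuation s = 1 ∧ x = a * s⁻¹} :=
    coe_ofField_centre O B.toSubring hBO
  have hBT : ∀ b : K, b ∈ B → b ∈ T₁ := fun b hb => by
    rw [← SetLike.mem_coe, hT₁]
    exact ⟨b, hb, 1, B.one_mem, by simp, by simp⟩
  let R₀ : Subalgebra k K :=
    { carrier := T₁
      mul_mem' := fun ha hb => T₁.mul_mem ha hb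
      one_mem' := T₁.one_mem
      add_mem' := fun ha hb => T₁.add_mem ha hb
      zero_mem' := T₁.zero_mem
      algebraMap_mem' := fun c => hBT _ (B.algebraMap_mem c) }
  have hR₀ : (R₀ : Set K) = {x | ∃ a ∈ B, ∃ s ∈ B, O.valuation s = 1 ∧ x = a * s⁻¹} := hT₁
  have hcomap : O.comap (algebraMap K K) = O := by
    ext x
    simp [ValuationSubring.mem_comap]
  have hR₀' : (R₀ : Set K) = {x | ∃ a ∈ B, ∃ s ∈ B,
      (O.comap (algebraMap K K)).valuation s = 1 ∧ x = a * s⁻¹} := by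
    rw [hcomap]
    exact hR₀
  refine ⟨R₀, ⟨⟨B, hBfg, hBfrac, hBO, hR₀⟩, fun x hx => ?_⟩, fun x hx => hBT x (hA₁B (hFA₁ x hx))⟩
  -- normality: clear denominators, use that `B` is integrally closed in `K`
  obtain ⟨S, hSB, hvS, hint⟩ :=
    exists_mem_integral_mul_of_isIntegralOverSub (L := K) O B R₀ hR₀' hx
  have hvS' : O.valuation S = 1 := by simpa using hvS
  have hS0 : S ≠ 0 := ne_zero_of_valuation_eq_one O hvS'
  have hint' : IsIntegral (integralClosure A₁ K) (S * x) := hint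
  have hSx : S * x ∈ B := (hmemB _).mpr (isIntegral_trans (A := integralClosure A₁ K) _ hint')
  show x ∈ (R₀ : Set K)
  rw [hR₀]
  exact ⟨S * x, hSx, S, hSB, hvS', by field_simp⟩

end NormalModel

/-! ### Prop. 6.2 (1) -/

section Main

/-- **Cossart–Piltant 2008, Proposition 6.2 (1) (Galois approximation) — PROVED**: the named
fact `CP2008.GaloisApproximation` ("`G_s(W/V) = G_s(R̃/R)` and `G_i(W/V) = G_i(R̃/R)` for every
normal local model `R` of `V/k` dominating a suitable `R₀`", HAL p. 17 (26)) holds.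
[cite: CossartPiltant2008, Prop 6.2 (1) (HAL p. 17)] -/
theorem galoisApproximation_holds : GaloisApproximation.{u} := by
  intro k K _ _ _ hKfg L _ _ _ _ hfin hgal W hkW
  classical
  haveI : FiniteDimensional K L := hfin
  haveI : IsGalois K L := hgal
  set V : ValuationSubring K := W.comap (algebraMap K L) with hV
  have hkV : ∀ c : k, algebraMap k K c ∈ V := fun c => by
    rw [hV, ValuationSubring.mem_comap, ← IsScalarTower.algebraMap_apply]
    exact hkW c
  -- one witness per group element
  have hw : ∀ τ : L ≃ₐ[K] L, ∃ y : L, (∀ ρ : L ≃ₐ[K] L, ρ y ∈ W) ∧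
      (τ • W ≠ W → W.valuation y = 1 ∧ W.valuation (τ y) < 1) ∧
      (τ • W = W → (¬ ∀ x : L, x ∈ W → W.valuation (τ x - x) < 1) →
        ¬ W.valuation (τ y - y) < 1) := by
    intro τ
    by_cases hτ : τ • W = W
    · by_cases hall : ∀ x : L, x ∈ W → W.valuation (τ x - x) < 1
      · refine ⟨0, fun ρ => by rw [map_zero]; exact zero_mem W, fun h => absurd hτ h,
          fun _ h => absurd hall h⟩
      · push Not at hall
        obtain ⟨x, hxW, hx⟩ := hall
        obtain ⟨y, hyB, hy⟩ := exists_inertia_witness W hτ hxW (not_lt.mpr hx)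
        exact ⟨y, hyB, fun h => absurd hτ h, fun _ _ => hy⟩
    · obtain ⟨b, hbB, hb1, hbτ⟩ := exists_separating W hτ
      exact ⟨b, hbB, fun _ => ⟨hb1, hbτ⟩, fun h => absurd h hτ⟩
  choose w hwB hsep hin using hw
  -- their integral equations over `V`
  have hq : ∀ τ : L ≃ₐ[K] L, ∃ q : K[X], q.Monic ∧ (∀ i, algebraMap K L (q.coeff i) ∈ W) ∧
      aeval (w τ) q = 0 := fun τ => exists_monic_of_forall_map_mem W (hwB τ)
  choose q hqm hqW hqy using hq
  let F : Finset K :=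
    Finset.univ.biUnion fun τ => (Finset.range ((q τ).natDegree + 1)).image (q τ).coeff
  have hFV : ∀ x ∈ F, x ∈ V := by
    intro x hx
    obtain ⟨τ, -, hx⟩ := Finset.mem_biUnion.mp hx
    obtain ⟨i, -, rfl⟩ := Finset.mem_image.mp hx
    rw [hV, ValuationSubring.mem_comap]
    exact hqW τ i
  obtain ⟨R₀, hR₀, hFR₀⟩ := exists_isNormalLocalModelOf_forall_mem hKfg V hkV F hFV
  refine ⟨R₀, hR₀, fun R hR hR₀R σ => ?_⟩
  -- for `R ⊇ R₀`: the witnesses are integral over `R`, `R ⊆ V`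
  have hRW : ∀ a ∈ R, algebraMap K L a ∈ W := fun a ha =>
    ValuationSubring.mem_comap.mp (hR.1.mem_of_mem ha)
  have hint : ∀ τ : L ≃ₐ[K] L, IsIntegralOverSub R (w τ) := by
    intro τ
    refine ⟨q τ, hqm τ, fun i => ?_, hqy τ⟩
    by_cases hi : i ≤ (q τ).natDegree
    · exact hR₀R (hFR₀ _ (Finset.mem_biUnion.mpr ⟨τ, Finset.mem_univ τ,
        Finset.mem_image.mpr ⟨i, Finset.mem_range.mpr (by omega), rfl⟩⟩))
    · rw [Polynomial.coeff_eq_zero_of_natDegree_lt (by omega)]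
      exact R.zero_mem
  -- `g.R̃ = R̃ ⇒ g.W = W`
  have hdec : σ '' normalModelAbove W R = normalModelAbove W R → σ • W = W := by
    intro himg
    by_contra hσW
    obtain ⟨hv1, hvlt⟩ := hsep σ hσW
    have hbinv : (w σ)⁻¹ ∈ normalModelAbove W R := inv_mem_normalModelAbove W (hint σ) hv1
    have h1 : σ (w σ)⁻¹ ∈ normalModelAbove W R := by
      rw [← himg]
      exact Set.mem_image_of_mem σ hbinv
    have hW : (σ (w σ))⁻¹ ∈ W := by
      rw [← map_inv₀]
      exact normalModelAbove_subset W hRW h1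
    have hne : σ (w σ) ≠ 0 :=
      (_root_.map_ne_zero σ).mpr (ne_zero_of_valuation_eq_one W hv1)
    have hle := (W.valuation_le_one_iff _).mpr hW
    rw [map_inv₀, inv_le_one₀ (W.valuation.pos_iff.mpr hne)] at hle
    exact absurd hvlt (not_lt.mpr hle)
  refine ⟨⟨fun hσ => image_normalModelAbove_eq W (MulAction.mem_stabilizer_iff.mp hσ),
    fun himg => MulAction.mem_stabilizer_iff.mpr (hdec himg)⟩, ?_⟩
  rw [← mem_inertiaGroup_iff W σ, mem_inertiaGroup_iff' W σ]
  constructor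
  · rintro ⟨hσW, hv⟩
    exact ⟨image_normalModelAbove_eq W hσW, fun x hx => hv x (normalModelAbove_subset W hRW hx)⟩
  · rintro ⟨himg, hv⟩
    have hσW : σ • W = W := hdec himg
    refine ⟨hσW, ?_⟩
    by_contra hbad
    exact hin σ hσW hbad (hv (w σ) (mem_normalModelAbove_of_isIntegralOverSub W (hint σ)))

end Main

end Literature.AlgebraicGeometry.CossartPiltant200819.CP2008
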